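import Literature.NumberTheory.LFunctions.NoRealZeroCertificateReplayTable17
import Literature.NumberTheory.LFunctions.NoRealZeroCertificateReplayTable18A
import Literature.NumberTheory.LFunctions.NoRealZeroCertificateReplayTable18B
import Literature.NumberTheory.LFunctions.NoRealZeroCertificateReplayTable18C
import Literature.NumberTheory.LFunctions.NoRealZeroCertificateReplayTable18D
import Literature.NumberTheory.LFunctions.NoRealZeroCertificateReplayTable18E
import Literature.NumberTheory.LFunctions.NoRealZeroCertificateReplayTable18F
import Literature.NumberTheory.LFunctions.NoRealZeroCertificateReplayTable18G
import HarnessLib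

/-!
# Kernel replay of the Lu–Zaman–Zhao certificates: the verified prime table for `p < 2^18`

Topic `Literature/NumberTheory/LFunctions`. Assembly of the kernel-verified prime tables of heavy tier 18:
`table18` = the concatenation of parts A, B, C, D, E, F, G (the 10749 primes `2^17 < p < 2^18`, verified
entrywise in `NoRealZeroCertificateReplayTable18<part>.lean`), `table18_sorted`, `table18_valid`, and
**`table15_18 = table15_17 ++ table18`** with **`table15_18_valid : TableValid table15_18`** (junction by the bound
`131072`, `TableValid.append_of_bound`). Used by the `…ReplayHeavy18N*` files (heavy discriminants whose Table-1
certificate at `λ = 1.6`, `c = 1/5` needs primes in `(2^17, 2^18)`; Lu–Zaman–Zhao arXiv:2602.03626 §3) through `checkListK`.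

## References

* W. Lu, A. Zaman, K. Zhao, *Dirichlet L-functions of quadratic characters have no exceptional
  zeros for moduli up to 10¹⁰*, Math. Comp. (2026), arXiv:2602.03626, §2.2–§3. [LuZamanZhao2026]
-/

namespace Literature.NumberTheory.LFunctions
namespace LuZamanZhao2026
namespace Replay

/-- **The verified prime table for `2^17 < p < 2^18`** (10749 primes). [folklore] -/
def table18 : List PRow :=
  table18A ++ (table18B ++ (table18C ++ (table18D ++ (table18E ++ (table18F ++ (table18G))))))

set_option maxHeartbeats 0 in
/-- The primes of `table18` increase strictly. [cite: LuZamanZhao2026, §2.2 and (2.3)] -/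
theorem table18_sorted : sortedCheck table18 = true := by
  decide +kernel

/-- **`table18` is a valid table.** [cite: LuZamanZhao2026, §2.2 and (2.3)] -/
theorem table18_valid : TableValid table18 :=
  tableValid_of (entryValid_append table18A_entryValid (entryValid_append table18B_entryValid (entryValid_append table18C_entryValid (entryValid_append table18D_entryValid (entryValid_append table18E_entryValid (entryValid_append table18F_entryValid table18G_entryValid)))))) table18_sorted

/-- **The verified prime table for `p < 2^18`**: `table15_18 = table15_17 ++ table18`. [folklore] -/
def table15_18 : List PRow :=
  table15_17 ++ table18

set_option maxHeartbeats 0 in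
/-- Every prime of `table15_17` is `< 131072`. [cite: LuZamanZhao2026, §2.2 and (2.3)] -/
theorem table15_17_allPLt_131072 : allPLt table15_17 131072 = true := by
  decide +kernel

set_option maxHeartbeats 0 in
/-- Every prime of `table18` is `≥ 131072`. [cite: LuZamanZhao2026, §2.2 and (2.3)] -/
theorem table18_allPGe : allPGe table18 131072 = true := by
  decide +kernel

/-- **`table15_18` is a valid table** — the hypothesis of `certifiedAt_of_checkListK` for heavy tier 18.
[cite: LuZamanZhao2026, §2.2 and (2.3)] -/
theorem table15_18_valid : TableValid table15_18 :=
  table15_17_valid.append_of_bound table18_valid 131072 table15_17_allPLt_131072 table18_allPGe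

end Replay
end LuZamanZhao2026
end Literature.NumberTheory.LFunctions
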